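import Summits.ResolutionOfSingularities.ResolutionOfSingularities.Theorems.HilbertSamuelEliminationSigmaMaxModificationsCorridor3SigmaSurfaceBadness
import HarnessLib

/-!
# [OURS · L1 W4.2] σ-LAYER PHASE B′ — `Corridor3SigmaMenuSurfaceCureStep`: THE CURE SUB-ORACLE OF RECORD `cureStepOfRecord : SurfacePrep` — the `cure`
# parameter of the (P1*) prep oracle `SurfacePrep.ofRecord regular phaseS bad cure point` (p543457): «on the regular surface `D` with `M > 0`: if some
# codimension-one component of the filtered trace configuration is BAD (`S_ζ ≥ 2`), blow up its REDUCED CURVE `cl{ι_D ζ}` in `W`; otherwise blow up the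
# REDUCED POINT `ι_D x` at a COUNTED CROSSING `x`» (bad components FIRST, crossings after), with its obligations split and the (P1) tier of record plugged
# (res-L1-w42-plan-1 RULING v3.14-43 (KN) «(R-a) M := multiplicity part + self-crossing count»; res-L1-w42-stub-1 19:36:06Z «centre = 𝓘(ι(cl ζ)) for a bad
# component, else the point at a counted crossing … still untyped»; typer res-L1-type-o1 g11 TAKING 19:37:55Z; crux chain w42 `SigmaMaxModifications`
# stmt-ResolutionOfSingularities-18506 / conjunct `SigmaMaxModificationsCorridor3` stmt-ResolutionOfSingularities-19249; `--supports stmt-…-19249 --as helper`,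
# counted 0)

HONEST FRAMING. OURS design bookkeeping over res-L1-w42-stub-1's badness count of record (`…Corridor3SigmaSurfaceBadness` p559520: `Boundary.codimOnePoints`,
`Boundary.compMults`, `Boundary.crossingPts`, `Boundary.badness`, `badOfRecord`, `badness_eq_zero_iff`), its F-75 point step (`…SigmaMenuSurfacePointStep`
p541133: `pointStepOfRecord`, `subschemeι_mem`, `isClosed_singleton_subschemeι`), this seat's (P1) tier (`…SigmaMenuSurfacePhase` p540556 / `…SigmaMenuSurfacePrep`
p543457+p544886: `SurfacePrep`, `SurfacePrep.ofRecord`, `surfacePhaseReadyTS`), res-type-067's `Boundary.restrictOff` / `menuCentre` and Mathlib's reduced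
closed subschemes (`Scheme.IdealSheafData.vanishingIdeal`). NOTHING here is a statement of H. Hironaka's manuscript [Hironaka2017] nor of Cossart–Jannsen–Saito
[CossartJannsenSaito2020]; no named fact. AI-typed; AI review is weaker than expert review.

## Contents (namespace `…Theorems.SigmaMaxModificationsCorridor3.Sigma`)

* `surfaceTraces E D` — the filtered trace LIST `E.restrictOff ι_D` on the reduced surface `D̃ = (menuCentre D).subscheme` (the list whose `badness` is
  `badOfRecord W E D` and whose `divisorSet` is `surfaceTraceSet E D`: `badOfRecord_eq_badness_surfaceTraces`, `surfaceTraceSet_eq_divisorSet_surfaceTraces`).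
* `IsBadComponent Γs ζ` — `ζ` is a codimension-one point of the configuration with total multiplicity `S_ζ ≥ 2` (stub-1's «BAD»); `componentCentre D ζ` — the
  REDUCED CURVE `𝓘(cl{ι_D ζ})` of `W` (`vanishingIdeal` of the closure); `coe_support_componentCentre`, `support_componentCentre_subset`.
* **`cureStepOfRecord : SurfacePrep`** — (a) `∃ ζ, IsBadComponent (surfaceTraces E D) ζ ∧ C = componentCentre D ζ` ∨ (b) `(no bad component) ∧
  ∃ Γ ∈ surfaceTraces E D, ∃ x ∈ crossingPts Γ, C = 𝓘(ι_D x)` (reduced closed point). ANY bad component / ANY counted crossing may be proposed — the tier's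
  choice makes the policy functional, exactly as for `pointStepOfRecord`; `cureStepOfRecord_iff`, `cureStepOfRecord_of_isBadComponent`,
  `cureStepOfRecord_of_crossing`.
* OBLIGATIONS: `cureStepOfRecord_support_subset` (`supp C ⊆ D`, both branches) ⇒ the «`⊆ X(ν)`» half of the `hcure` binder is DISCHARGED on surface components;
  the «`C` regular» half: branch (b) DISCHARGED (`isRegular_subscheme_vanishingIdeal_singleton`), branch (a) is the ONE named reading hypothesis
  **`BadComponentsRegular regular bad N ν`** («whenever the cure fires — `D` a regular surface component, `0 < bad` — the reduced curve of a bad component is a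
  regular subscheme of `W`»; true once `S(E, D)` is snc, i.e. under the ℓ-gate `badGatedOfRecord` at `ℓ = 0`; discharger: stub-1 / res-type-067 with the
  transport) — **`cureStepOfRecord_regular_subset`** delivers the `hcure` binder of `SurfacePrep.ofRecord_regular_subset` from it.
* SILENCE / SPEECH: `compMults_eq_singleton_one_of_not_two_le_sum` (a non-bad component is carried once with order one), **`not_cureStepOfRecord_of_badness_eq_zero`**
  (`M = 0` ⇒ the cure is silent; stub-1's finiteness / non-zero-stalk premises), **`exists_cureStepOfRecord_of_badness_ne_zero`** (`M ≠ 0` ⇒ the cure PROPOSES,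
  modulo closedness in `W` of the counted crossing points — `hXcl`, a coheight-zero bookkeeping left to the badness file's owner).
* PLUGGED: **`SurfacePrep.ofRecord_regular_subset_cureStep_pointStep`** and **`StrategyE.surfacePhaseReadyTS_cureStep_pointStep_isStratumDisciplined`** — the
  (P1) tier of record `surfacePhaseReadyTS regular phaseS bad cureStepOfRecord pointStepOfRecord` is stratum-disciplined modulo PHASE S's obligation `hS` and
  `BadComponentsRegular` only; `…_isFunctional` unconditionally.

VACUITY SELF-CHECK. `cureStepOfRecord` is silent iff `M(E, D) = 0` (under the finiteness premises and `hXcl`): stub-1's DESIGN CHECK 1 witness (one member with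
trace `V(xy)` on `D̃ ≅ 𝔸²`: no bad component, ONE counted crossing at the origin) gets exactly the proposal (b) «blow up the origin», as RULING -43 (KN) ruled; a
doubled trace (`compMults = [2]` or `[1,1]`) gets proposal (a). `BadComponentsRegular` is NOT vacuous (it fails for a cuspidal trace carried twice at `ℓ > 0`) and
is only consulted behind the ℓ-gate. The M-DROP laws at the proposed centres are stub-1's (`badness_cureAlong_lt` p562968 + transport), not here.
-/

noncomputable section

set_option linter.dupNamespace false -- mandated namespace of this single-conjunct summit

open CategoryTheory AlgebraicGeometry TopologicalSpace
open Summit.ResolutionOfSingularities.ResolutionOfSingularities.Theorems.CampaignW42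
open Literature.AlgebraicGeometry.Resolution Literature.RingTheory.HilbertSamuel

namespace Summit.ResolutionOfSingularities.ResolutionOfSingularities.Theorems.SigmaMaxModificationsCorridor3.Sigma

universe u

open Scheme.IdealSheafData

variable {W : Scheme.{u}}

/-! ## The trace list, bad components, the curve centre -/

/-- [OURS · L1 W4.2] **THE FILTERED TRACE LIST** `Γs(E, D) := E.restrictOff ι_D` on the reduced surface `D̃ = (menuCentre D).subscheme` (members containing `D`
dropped, the others pulled back; res-type-067's `Boundary.restrictOff`). Its `badness` is stub-1's `badOfRecord W E D`, its `divisorSet` is `surfaceTraceSet E D`.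
NOT a statement of the manuscript. [folklore] -/
abbrev surfaceTraces (E : Boundary W) (D : Closeds W) : Boundary (menuCentre D).subscheme :=
  E.restrictOff (menuCentre D).subschemeι

/-- `M(E, D)` is the badness of the trace list (`rfl`). [folklore] -/
theorem badOfRecord_eq_badness_surfaceTraces (E : Boundary W) (D : Closeds W) : badOfRecord W E D = (surfaceTraces E D).badness :=
  rfl

/-- `S(E, D)` is the divisor set of the trace list (`rfl`). [folklore] -/
theorem surfaceTraceSet_eq_divisorSet_surfaceTraces (E : Boundary W) (D : Closeds W) : surfaceTraceSet E D = (surfaceTraces E D).divisorSet :=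
  rfl

/-- [OURS · L1 W4.2] **A BAD COMPONENT** of a trace list `Γs` on `D`: a codimension-one point `ζ` of the configuration whose total multiplicity
`S_ζ = Σ compMults ζ` is `≥ 2` (shared by two members, or carried with order `≥ 2`) — stub-1's «BAD» (`Boundary.crossingPts` docstring). NOT a statement of the
manuscript. [folklore] -/
def IsBadComponent {D : Scheme.{u}} (Γs : Boundary D) (ζ : D) : Prop :=
  ζ ∈ Γs.codimOnePoints ∧ 2 ≤ (Γs.compMults ζ).sum

/-- Unfolding (`Iff.rfl`). [folklore] -/
theorem isBadComponent_iff {D : Scheme.{u}} {Γs : Boundary D} {ζ : D} :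
    IsBadComponent Γs ζ ↔ ζ ∈ Γs.codimOnePoints ∧ 2 ≤ (Γs.compMults ζ).sum :=
  Iff.rfl

/-- [OURS · L1 W4.2] **THE CURVE CENTRE UNDER A COMPONENT**: the REDUCED closed subscheme of `W` on the closure of `ι_D ζ` — for `ζ` a codimension-one point of
the trace configuration on `D̃`, the reduced irreducible curve `cl{ι_D ζ} ⊆ D` (Mathlib `vanishingIdeal`). NOT a statement of the manuscript. [folklore] -/
def componentCentre (D : Closeds W) (ζ : ↥(menuCentre D).subscheme) : W.IdealSheafData :=
  vanishingIdeal ⟨closure {(menuCentre D).subschemeι ζ}, isClosed_closure⟩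

/-- The support of the curve centre is the closure of the point. [folklore] -/
theorem coe_support_componentCentre (D : Closeds W) (ζ : ↥(menuCentre D).subscheme) :
    ((componentCentre D ζ).support : Set W) = closure {(menuCentre D).subschemeι ζ} := by
  simp only [componentCentre, Scheme.IdealSheafData.coe_support_vanishingIdeal, TopologicalSpace.Closeds.coe_mk]

/-- The curve centre lies inside `D` (`D` is closed and contains `ι_D ζ`). [folklore] -/
theorem support_componentCentre_subset (D : Closeds W) (ζ : ↥(menuCentre D).subscheme) :
    ((componentCentre D ζ).support : Set W) ⊆ (D : Set W) := by
  rw [coe_support_componentCentre]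
  exact closure_minimal (Set.singleton_subset_iff.mpr (subschemeι_mem D ζ)) D.isClosed

/-! ## The cure sub-oracle -/

/-- [OURS · L1 W4.2] **THE CURE SUB-ORACLE OF RECORD** — the `cure` parameter of `SurfacePrep.ofRecord regular phaseS bad cure point`: for the surface `D` at the
state `(W, L, P, E)`, with `Γs := surfaceTraces E D` the filtered traces on `D̃`, propose as centre
(a) the REDUCED CURVE `componentCentre D ζ` of ANY BAD component `ζ` (`IsBadComponent Γs ζ`), or — if NO component is bad —
(b) the REDUCED CLOSED POINT `𝓘(ι_D x)` at ANY COUNTED CROSSING `x ∈ Γs.crossingPts Γ` of a member `Γ ∈ Γs`.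
Bad components first, crossings after (res-L1-w42-stub-1 19:36:06Z). State-blind except through `E` and `D`; the (P1) tier gates it behind `regular D ∧ 0 < bad`
and makes the choice. NOT a statement of the manuscript. [folklore] -/
def cureStepOfRecord : SurfacePrep.{u} :=
  fun W _ _ _ _ _ E D C =>
    (∃ ζ : ↥(menuCentre D).subscheme, IsBadComponent (surfaceTraces E D) ζ ∧ C = componentCentre D ζ) ∨
      ((∀ ζ : ↥(menuCentre D).subscheme, ¬ IsBadComponent (surfaceTraces E D) ζ) ∧
        ∃ Γ ∈ surfaceTraces E D, ∃ x ∈ (surfaceTraces E D).crossingPts Γ, ∃ (hx : IsClosed ({(menuCentre D).subschemeι x} : Set W)),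
          C = vanishingIdeal ⟨{(menuCentre D).subschemeι x}, hx⟩)

variable {hW : IsLocallyNoetherian W} {N : ℕ} {ν : ℕ → ℕ} {L : Labelling W} {P : Option (Pending W)} {E : Boundary W} {D : Closeds W} {C : W.IdealSheafData}

/-- Unfolding (`Iff.rfl`). [folklore] -/
theorem cureStepOfRecord_iff :
    cureStepOfRecord W hW N ν L P E D C ↔
      (∃ ζ : ↥(menuCentre D).subscheme, IsBadComponent (surfaceTraces E D) ζ ∧ C = componentCentre D ζ) ∨
        ((∀ ζ : ↥(menuCentre D).subscheme, ¬ IsBadComponent (surfaceTraces E D) ζ) ∧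
          ∃ Γ ∈ surfaceTraces E D, ∃ x ∈ (surfaceTraces E D).crossingPts Γ, ∃ (hx : IsClosed ({(menuCentre D).subschemeι x} : Set W)),
            C = vanishingIdeal ⟨{(menuCentre D).subschemeι x}, hx⟩) :=
  Iff.rfl

/-- Branch (a): a bad component's reduced curve is proposed. [folklore] -/
theorem cureStepOfRecord_of_isBadComponent {ζ : ↥(menuCentre D).subscheme} (hζ : IsBadComponent (surfaceTraces E D) ζ) :
    cureStepOfRecord W hW N ν L P E D (componentCentre D ζ) :=
  Or.inl ⟨ζ, hζ, rfl⟩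

/-- Branch (b): with no bad component, the reduced point at a counted crossing is proposed. [folklore] -/
theorem cureStepOfRecord_of_crossing (hno : ∀ ζ : ↥(menuCentre D).subscheme, ¬ IsBadComponent (surfaceTraces E D) ζ)
    {Γ : (menuCentre D).subscheme.IdealSheafData} (hΓ : Γ ∈ surfaceTraces E D) {x : ↥(menuCentre D).subscheme}
    (hx : x ∈ (surfaceTraces E D).crossingPts Γ) (hxcl : IsClosed ({(menuCentre D).subschemeι x} : Set W)) :
    cureStepOfRecord W hW N ν L P E D (vanishingIdeal ⟨{(menuCentre D).subschemeι x}, hxcl⟩) :=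
  Or.inr ⟨hno, Γ, hΓ, x, hx, hxcl, rfl⟩

/-! ## Obligations: support inside `D`, regularity split -/

/-- **EVERY PROPOSED CENTRE LIES INSIDE `D`** (both branches). [folklore] -/
theorem cureStepOfRecord_support_subset (h : cureStepOfRecord W hW N ν L P E D C) : (C.support : Set W) ⊆ (D : Set W) := by
  rcases h with ⟨ζ, -, rfl⟩ | ⟨-, Γ, -, x, -, hx, rfl⟩
  · exact support_componentCentre_subset D ζ
  · rw [Scheme.IdealSheafData.coe_support_vanishingIdeal]
    rintro _ rfl
    exact subschemeι_mem D x

/-- … hence inside `X(ν)` when `D` is a surface component of the stratum. [folklore] -/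
theorem cureStepOfRecord_support_subset_hsStratum (hD : (D : Set W) ∈ surfaceComponents W N ν) (h : cureStepOfRecord W hW N ν L P E D C) :
    (C.support : Set W) ⊆ Scheme.hsStratum W N ν :=
  (cureStepOfRecord_support_subset h).trans (subset_hsStratum_of_mem_surfaceComponents hD)

/-- [OURS · L1 W4.2] **READING HYPOTHESIS «BAD COMPONENTS ARE REGULAR CURVES WHEN THE CURE FIRES»**: at every state where the (P1*) case rule calls the cure
— `D` a surface component of `X(ν)`, `regular W D`, `0 < bad W E D` — the reduced curve `componentCentre D ζ` of every bad component `ζ` of the filtered traces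
is a REGULAR subscheme of `W`. True behind the ℓ-gate of record (`bad := badGatedOfRecord`: `0 < bad'` forces `ℓ(E, D) = 0`, i.e. `S(E, D)` snc on the regular
surface `D̃`, so its components are regular curves, and the reduced structure transports along the closed immersion `ι_D`); dischargers: res-L1-w42-stub-1 /
res-type-067 (the trace transport). The branch-(a) half of the `hcure` obligation. NOT a statement of the manuscript. [folklore] -/
def BadComponentsRegular (regular : SurfaceRegularity.{u}) (bad : SurfaceBadness.{u}) (N : ℕ) (ν : ℕ → ℕ) : Prop :=
  ∀ (W : Scheme.{u}) (_ : IsLocallyNoetherian W) (E : Boundary W) (D : Closeds W), (D : Set W) ∈ surfaceComponents W N ν → regular W D →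
    0 < bad W E D → ∀ ζ : ↥(menuCentre D).subscheme, IsBadComponent (surfaceTraces E D) ζ → Scheme.IsRegular (componentCentre D ζ).subscheme

/-- **THE `hcure` OBLIGATION, REDUCED TO `BadComponentsRegular`** (binder shape of `SurfacePrep.ofRecord_regular_subset` / `surfacePhaseReadyTS_isStratumDisciplined`
VERBATIM): on a surface component `D` of `X(ν)` with `regular W D` and `0 < bad W E D`, every centre the cure proposes is regular (branch (a) by the hypothesis,
branch (b) a reduced closed point — `isRegular_subscheme_vanishingIdeal_singleton`) and lies in `D ⊆ X(ν)`. [folklore] -/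
theorem cureStepOfRecord_regular_subset {regular : SurfaceRegularity.{u}} {bad : SurfaceBadness.{u}} (hreg : BadComponentsRegular regular bad N ν) :
    ∀ (W : Scheme.{u}) (hW : IsLocallyNoetherian W) (L : Labelling W) (P : Option (Pending W)) (E : Boundary W) (D : Closeds W) (C : W.IdealSheafData),
      (D : Set W) ∈ surfaceComponents W N ν → regular W D → 0 < bad W E D → cureStepOfRecord W hW N ν L P E D C →
        Scheme.IsRegular C.subscheme ∧ (C.support : Set W) ⊆ Scheme.hsStratum W N ν := by
  intro W hW L P E D C hD hr hM h
  refine ⟨?_, cureStepOfRecord_support_subset_hsStratum hD h⟩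
  rcases h with ⟨ζ, hζ, rfl⟩ | ⟨-, Γ, -, x, -, hx, rfl⟩
  · exact hreg W hW E D hD hr hM ζ hζ
  · haveI := hW
    exact isRegular_subscheme_vanishingIdeal_singleton hx

/-! ## Silence at `M = 0`, speech at `M ≠ 0` -/

section Speech

variable {D' : Scheme.{u}} {Γs : Boundary D'}

/-- A non-empty list of positive naturals with sum `< 2` is `[1]`. [folklore] -/
theorem List.eq_singleton_one_of_forall_one_le_of_not_two_le_sum {l : List ℕ} (hne : l ≠ []) (h1 : ∀ m ∈ l, 1 ≤ m) (hlt : ¬ 2 ≤ l.sum) :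
    l = [1] := by
  match l, hne, h1, hlt with
  | [a], _, h1, hlt =>
    have ha := h1 a (by simp)
    simp only [List.sum_cons, List.sum_nil, add_zero] at hlt
    have : a = 1 := by omega
    rw [this]
  | a :: b :: t, _, h1, hlt =>
    have ha := h1 a (by simp)
    have hb := h1 b (by simp)
    simp only [List.sum_cons] at hlt
    omega

/-- **A NON-BAD component is carried once with order one** (non-zero stalks): `¬ 2 ≤ S_ζ ⇒ compMults ζ = [1]`. [folklore] -/
theorem compMults_eq_singleton_one_of_not_two_le_sum {ζ : D'} [IsNoetherianRing (D'.presheaf.stalk ζ)] (hnz : ∀ Γ ∈ Γs, stalkIdeal Γ ζ ≠ ⊥)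
    (hζ : ζ ∈ Γs.divisorSet) (h : ¬ 2 ≤ (Γs.compMults ζ).sum) : Γs.compMults ζ = [1] :=
  List.eq_singleton_one_of_forall_one_le_of_not_two_le_sum (Boundary.compMults_ne_nil hζ) (Boundary.one_le_of_mem_compMults hnz) h

/-- … so its badness `μ_ζ` vanishes. [folklore] -/
theorem compBadness_eq_zero_of_not_isBadComponent {ζ : D'} [IsNoetherianRing (D'.presheaf.stalk ζ)] (hnz : ∀ Γ ∈ Γs, stalkIdeal Γ ζ ≠ ⊥)
    (hζ : ζ ∈ Γs.codimOnePoints) (h : ¬ IsBadComponent Γs ζ) : Γs.compBadness ζ = 0 := by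
  rw [Boundary.compBadness_eq_zero_iff hnz hζ.1]
  exact compMults_eq_singleton_one_of_not_two_le_sum hnz hζ.1 fun h2 => h ⟨hζ, h2⟩

end Speech

/-- **`M = 0` ⇒ THE CURE IS SILENT** (stub-1's finiteness / non-zero-stalk premises): no component is bad (`not_two_le_sum_of_badness_eq_zero`) and no member has
a counted crossing (`badness_eq_zero_iff`). Consistency with the case rule: `SurfacePrep.ofRecord` never calls the cure at `M = 0`. [folklore] -/
theorem not_cureStepOfRecord_of_badness_eq_zero [IsLocallyNoetherian (menuCentre D).subscheme]
    (hfinT : (surfaceTraces E D).codimOnePoints.Finite) (hfinX : ∀ Γ ∈ surfaceTraces E D, ((surfaceTraces E D).crossingPts Γ).Finite)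
    (hnz : ∀ Γ ∈ surfaceTraces E D, ∀ x : ↥(menuCentre D).subscheme, stalkIdeal Γ x ≠ ⊥) (hM : (surfaceTraces E D).badness = 0) :
    ¬ cureStepOfRecord W hW N ν L P E D C := by
  rintro (⟨ζ, ⟨hζ, h2⟩, -⟩ | ⟨-, Γ, hΓ, x, hx, -, -⟩)
  · exact Boundary.not_two_le_sum_of_badness_eq_zero hfinT hfinX hnz hM hζ h2
  · rw [((Boundary.badness_eq_zero_iff hfinT hfinX).mp hM).2 Γ hΓ] at hx
    exact hx

/-- **`M ≠ 0` ⇒ THE CURE PROPOSES** (liveness of the prep oracle at `ℓ = 0 ∧ M > 0`), modulo the closedness in `W` of the counted crossing points (`hXcl` —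
coheight bookkeeping: a point under two distinct codimension-one points of a Noetherian surface is closed; left to the badness file's owner): either some component
is bad (branch (a)) or, all `μ_ζ` vanishing, some member has a counted crossing (`badness_eq_zero_iff`, branch (b)). [folklore] -/
theorem exists_cureStepOfRecord_of_badness_ne_zero [IsLocallyNoetherian (menuCentre D).subscheme]
    (hfinT : (surfaceTraces E D).codimOnePoints.Finite) (hfinX : ∀ Γ ∈ surfaceTraces E D, ((surfaceTraces E D).crossingPts Γ).Finite)
    (hnz : ∀ Γ ∈ surfaceTraces E D, ∀ x : ↥(menuCentre D).subscheme, stalkIdeal Γ x ≠ ⊥)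
    (hXcl : ∀ Γ ∈ surfaceTraces E D, ∀ x ∈ (surfaceTraces E D).crossingPts Γ, IsClosed ({(menuCentre D).subschemeι x} : Set W))
    (hM : (surfaceTraces E D).badness ≠ 0) :
    ∃ C : W.IdealSheafData, cureStepOfRecord W hW N ν L P E D C := by
  by_cases hbad : ∃ ζ : ↥(menuCentre D).subscheme, IsBadComponent (surfaceTraces E D) ζ
  · obtain ⟨ζ, hζ⟩ := hbad
    exact ⟨_, cureStepOfRecord_of_isBadComponent hζ⟩
  · have hbad' : ∀ ζ : ↥(menuCentre D).subscheme, ¬ IsBadComponent (surfaceTraces E D) ζ := not_exists.mp hbad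
    have hμ : ∀ ζ ∈ (surfaceTraces E D).codimOnePoints, (surfaceTraces E D).compBadness ζ = 0 :=
      fun ζ hζ => compBadness_eq_zero_of_not_isBadComponent (fun Γ hΓ => hnz Γ hΓ ζ) hζ (hbad' ζ)
    by_contra hnone
    refine hM ((Boundary.badness_eq_zero_iff hfinT hfinX).mpr ⟨hμ, fun Γ hΓ => ?_⟩)
    by_contra hne
    obtain ⟨x, hx⟩ := Set.nonempty_iff_ne_empty.mpr hne
    exact hnone ⟨_, cureStepOfRecord_of_crossing hbad' hΓ hx (hXcl Γ hΓ x hx)⟩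

/-- With the reading of record `bad := badOfRecord`: `0 < badOfRecord W E D` ⇒ the cure proposes (same premises). [folklore] -/
theorem exists_cureStepOfRecord_of_badOfRecord_pos [IsLocallyNoetherian (menuCentre D).subscheme]
    (hfinT : (surfaceTraces E D).codimOnePoints.Finite) (hfinX : ∀ Γ ∈ surfaceTraces E D, ((surfaceTraces E D).crossingPts Γ).Finite)
    (hnz : ∀ Γ ∈ surfaceTraces E D, ∀ x : ↥(menuCentre D).subscheme, stalkIdeal Γ x ≠ ⊥)
    (hXcl : ∀ Γ ∈ surfaceTraces E D, ∀ x ∈ (surfaceTraces E D).crossingPts Γ, IsClosed ({(menuCentre D).subschemeι x} : Set W))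
    (hM : 0 < badOfRecord W E D) :
    ∃ C : W.IdealSheafData, cureStepOfRecord W hW N ν L P E D C :=
  exists_cureStepOfRecord_of_badness_ne_zero hfinT hfinX hnz hXcl (Nat.pos_iff_ne_zero.mp hM)

/-! ## Plugged: the (P1) tier of record with the cure and the point step -/

section Plugged

variable {regular : SurfaceRegularity.{u}} {phaseS : SurfacePrep.{u}} {bad : SurfaceBadness.{u}}

/-- **`SurfacePrep.ofRecord_regular_subset` WITH CURE AND POINT STEP PLUGGED**: only PHASE S's obligation `hS` and `BadComponentsRegular` remain. [folklore] -/
theorem SurfacePrep.ofRecord_regular_subset_cureStep_pointStep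
    (hS : ∀ (W : Scheme.{u}) (hW : IsLocallyNoetherian W) (L : Labelling W) (P : Option (Pending W)) (E : Boundary W) (D : Closeds W)
      (C : W.IdealSheafData), (D : Set W) ∈ surfaceComponents W N ν → ¬ regular W D → phaseS W hW N ν L P E D C →
        Scheme.IsRegular C.subscheme ∧ (C.support : Set W) ⊆ Scheme.hsStratum W N ν)
    (hreg : BadComponentsRegular regular bad N ν) :
    ∀ (W : Scheme.{u}) (hW : IsLocallyNoetherian W) (L : Labelling W) (P : Option (Pending W)) (E : Boundary W) (D : Closeds W)
      (C : W.IdealSheafData), (D : Set W) ∈ surfaceComponents W N ν →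
        SurfacePrep.ofRecord regular phaseS bad cureStepOfRecord pointStepOfRecord W hW N ν L P E D C →
        Scheme.IsRegular C.subscheme ∧ (C.support : Set W) ⊆ Scheme.hsStratum W N ν :=
  SurfacePrep.ofRecord_regular_subset hS (cureStepOfRecord_regular_subset hreg) (pointStepOfRecord_regular_subset regular bad)

/-- **THE (P1) TIER OF RECORD — TRUE-SET READINESS, CURE, POINT STEP — IS STRATUM-DISCIPLINED** modulo PHASE S's obligation and `BadComponentsRegular`
(`surfacePhaseReadyTS_isStratumDisciplined` with `hcure`, `hpoint` discharged). [folklore] -/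
theorem StrategyE.surfacePhaseReadyTS_cureStep_pointStep_isStratumDisciplined
    (hS : ∀ (W : Scheme.{u}) (hW : IsLocallyNoetherian W) (L : Labelling W) (P : Option (Pending W)) (E : Boundary W) (D : Closeds W)
      (C : W.IdealSheafData), (D : Set W) ∈ surfaceComponents W N ν → ¬ regular W D → phaseS W hW N ν L P E D C →
        Scheme.IsRegular C.subscheme ∧ (C.support : Set W) ⊆ Scheme.hsStratum W N ν)
    (hreg : BadComponentsRegular regular bad N ν) :
    (StrategyE.surfacePhaseReadyTS regular phaseS bad cureStepOfRecord pointStepOfRecord).IsStratumDisciplined N ν :=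
  StrategyE.surfacePhaseReadyTS_isStratumDisciplined hS (cureStepOfRecord_regular_subset hreg) (pointStepOfRecord_regular_subset regular bad)

/-- The same tier is functional (o1's `surfacePhaseReadyTS_isFunctional`). [folklore] -/
theorem StrategyE.surfacePhaseReadyTS_cureStep_pointStep_isFunctional (regular : SurfaceRegularity.{u}) (phaseS : SurfacePrep.{u})
    (bad : SurfaceBadness.{u}) (N : ℕ) (ν : ℕ → ℕ) :
    (StrategyE.surfacePhaseReadyTS regular phaseS bad cureStepOfRecord pointStepOfRecord).IsFunctional N ν :=
  StrategyE.surfacePhaseReadyTS_isFunctional regular phaseS bad cureStepOfRecord pointStepOfRecord N ν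

end Plugged

end Summit.ResolutionOfSingularities.ResolutionOfSingularities.Theorems.SigmaMaxModificationsCorridor3.Sigma

end
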